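import Mathlib
import HarnessLib

/-!
# Smeared chart identity (stub `stub_smearedChartIdentity`, crux `PencilRigidity.ShellRigidity`,
line `thales-slit-exact-cone-type`, stmt-QuantumFields-11685)

Informal statement. Let `μ` be a finite measure on `ℝ⁴` (coordinates `p 0 = energy`,
`p 1, p 2, p 3 = momenta`) carried by the light cone `{p 0 ≥ |p 1|}`, i.e.
`μ {p 0 < |p 1|} = 0`, and let `Q = [0, δ]²`. Put `Φ(p) = |∫_Q e^{i(w₁ p₂ + w₂ p₃)} dw|²`.
Then `Φ` is measurable, `0 ≤ Φ ≤ λ(Q)² = δ⁴`, and for all `A > |B|` the weight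
`e^{-(A p₀ + B p₁)} Φ` is `μ`-integrable and
`∫_Q ∫_Q Re (∫ exp(-(A p₀ + B p₁) + i((w₁-w₁') p₂ + (w₂-w₂') p₃)) dμ) dw' dw
  = ∫ e^{-(A p₀ + B p₁)} Φ dμ`.

Proof. Pure Fubini. On the cone `A p₀ + B p₁ ≥ (A - |B|) p₀ ≥ 0`, so the triple integrand has
modulus `e^{-(A p₀ + B p₁)} ≤ 1` almost everywhere for the (finite) product of `λ|_Q ⊗ λ|_Q`
with `μ` and is integrable; moving the `p`-integral outside (`MeasureTheory.integral_prod`,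
`MeasureTheory.integral_integral_swap`) and factorising
`∫_Q∫_Q e^{i(w-w')·q} dw dw' = (∫_Q e^{iw·q} dw) · conj (∫_Q e^{iw·q} dw) = |∫_Q e^{iw·q} dw|²`
(`MeasureTheory.integral_prod_mul`, `integral_conj`, `Complex.mul_conj`) gives the identity; the
real part commutes with the two outer integrals by `integral_re`.

No definitions; Mathlib only.
-/

noncomputable section

namespace Summit.QuantumFields.YangMills.Cruxes.ShellRigidity.ThalesSlitExactConeType

open MeasureTheory Complex Real
open scoped InnerProductSpace BigOperators ComplexConjugate

local notation "E4" => EuclideanSpace ℝ (Fin 4)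

namespace SmearedChartIdentity

/-- Factorisation of the triple integrand:
`e^{a + i(u - v)} = e^{a} · e^{iu} · conj (e^{iv})` for real `a u v`. -/
theorem cexp_factor (a u v : ℝ) :
    cexp ((a : ℂ) + ((u - v : ℝ) : ℂ) * I) =
      ((Real.exp a : ℝ) : ℂ) * (cexp ((u : ℂ) * I) * conj (cexp ((v : ℂ) * I))) := by
  rw [← Complex.exp_conj, map_mul, Complex.conj_ofReal, Complex.conj_I, Complex.ofReal_exp,
    ← Complex.exp_add, ← Complex.exp_add]
  congr 1
  push_cast
  ring

/-- The modulus of `e^{a + ib}` is `e^{a}` for real `a b`. -/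
theorem norm_cexp_eq (a b : ℝ) : ‖cexp ((a : ℂ) + (b : ℂ) * I)‖ = Real.exp a := by
  rw [Complex.norm_exp]
  simp

/-- On the light cone `|y| ≤ x` the weight exponent `A x + B y` is nonnegative when `|B| < A`. -/
theorem weight_nonneg {A B x y : ℝ} (hAB : |B| < A) (hxy : |y| ≤ x) : 0 ≤ A * x + B * y := by
  have h1 : -(|B| * |y|) ≤ B * y := by
    rw [← abs_mul]
    exact neg_abs_le _
  have h2 : |B| * |y| ≤ |B| * x := mul_le_mul_of_nonneg_left hxy (abs_nonneg B)
  have h3 : 0 ≤ |y| := abs_nonneg y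
  have h4 : 0 ≤ |B| := abs_nonneg B
  nlinarith

/-- On the light cone `|y| ≤ x` the weight `e^{-(A x + B y)}` is at most `1` when `|B| < A`. -/
theorem exp_weight_le_one {A B x y : ℝ} (hAB : |B| < A) (hxy : |y| ≤ x) :
    Real.exp (-(A * x + B * y)) ≤ 1 := by
  rw [Real.exp_le_one_iff, neg_nonpos]
  exact weight_nonneg hAB hxy

/-- The box-smeared plane-wave integral: for a measure `ν` on `ℝ²`, a point `p ∈ ℝ⁴` and a
real `a`, `∫∫ e^{a + i((w₁-w₁') p₂ + (w₂-w₂') p₃)} d(ν ⊗ ν) = e^{a} |∫ e^{i(w₁ p₂ + w₂ p₃)} dν|²`. -/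
theorem inner_integral (ν : Measure (ℝ × ℝ)) [SFinite ν] (p : E4) (a : ℝ) :
    ∫ x, cexp ((a : ℂ) + (((x.1.1 - x.2.1) * p 2 + (x.1.2 - x.2.2) * p 3 : ℝ) : ℂ) * I)
        ∂(ν.prod ν)
      = ((Real.exp a *
          Complex.normSq (∫ w, cexp (((w.1 * p 2 + w.2 * p 3 : ℝ) : ℂ) * I) ∂ν) : ℝ) : ℂ) := by
  have h1 : ∀ x : (ℝ × ℝ) × (ℝ × ℝ),
      cexp ((a : ℂ) + (((x.1.1 - x.2.1) * p 2 + (x.1.2 - x.2.2) * p 3 : ℝ) : ℂ) * I)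
        = ((Real.exp a : ℝ) : ℂ) * (cexp (((x.1.1 * p 2 + x.1.2 * p 3 : ℝ) : ℂ) * I) *
            conj (cexp (((x.2.1 * p 2 + x.2.2 * p 3 : ℝ) : ℂ) * I))) := by
    intro x
    rw [← cexp_factor]
    congr 4
    ring
  have h2 := integral_prod_mul (μ := ν) (ν := ν)
    (fun w : ℝ × ℝ => cexp (((w.1 * p 2 + w.2 * p 3 : ℝ) : ℂ) * I))
    (fun w : ℝ × ℝ => conj (cexp (((w.1 * p 2 + w.2 * p 3 : ℝ) : ℂ) * I)))
  beta_reduce at h2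
  rw [integral_congr_ae (ae_of_all _ h1), integral_const_mul, h2, integral_conj,
    Complex.mul_conj, Complex.ofReal_mul]

/-- Measurability in `p` of the box integral `p ↦ ∫ e^{i(w₁ p₂ + w₂ p₃)} dν(w)`. -/
theorem stronglyMeasurable_boxIntegral (ν : Measure (ℝ × ℝ)) [SFinite ν] :
    StronglyMeasurable fun p : E4 =>
      ∫ w, cexp (((w.1 * p 2 + w.2 * p 3 : ℝ) : ℂ) * I) ∂ν :=
  StronglyMeasurable.integral_prod_right
    (f := fun (p : E4) (w : ℝ × ℝ) => cexp (((w.1 * p 2 + w.2 * p 3 : ℝ) : ℂ) * I))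
    (by fun_prop : Continuous fun z : E4 × (ℝ × ℝ) =>
      cexp (((z.2.1 * z.1 2 + z.2.2 * z.1 3 : ℝ) : ℂ) * I)).stronglyMeasurable

/-- **The Fubini identity.** For finite measures `μ` on `ℝ⁴` and `ν` on `ℝ²` and reals `A B`
with `e^{-(A p₀ + B p₁)} ≤ 1` for `μ`-a.e. `p`,
`∫∫ Re (∫ e^{-(A p₀ + B p₁) + i((w₁-w₁') p₂ + (w₂-w₂') p₃)} dμ) dν(w') dν(w)
  = ∫ e^{-(A p₀ + B p₁)} |∫ e^{i(w₁ p₂ + w₂ p₃)} dν(w)|² dμ`. -/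
theorem smeared_identity (μ : Measure E4) [IsFiniteMeasure μ] (ν : Measure (ℝ × ℝ))
    [IsFiniteMeasure ν] (A B : ℝ) (hle : ∀ᵐ p ∂μ, Real.exp (-(A * p 0 + B * p 1)) ≤ 1) :
    ∫ w, ∫ w', (∫ p, cexp ((((-(A * p 0 + B * p 1)) : ℝ) : ℂ) +
        (((w.1 - w'.1) * p 2 + (w.2 - w'.2) * p 3 : ℝ) : ℂ) * I) ∂μ).re ∂ν ∂ν
      = ∫ p, Real.exp (-(A * p 0 + B * p 1)) *
          Complex.normSq (∫ w, cexp (((w.1 * p 2 + w.2 * p 3 : ℝ) : ℂ) * I) ∂ν) ∂μ := by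
  -- the triple integrand is continuous and a.e. bounded by `1`, hence integrable
  have I1 : Integrable (fun z : ((ℝ × ℝ) × (ℝ × ℝ)) × E4 =>
      cexp ((((-(A * z.2 0 + B * z.2 1)) : ℝ) : ℂ) +
        (((z.1.1.1 - z.1.2.1) * z.2 2 + (z.1.1.2 - z.1.2.2) * z.2 3 : ℝ) : ℂ) * I))
      ((ν.prod ν).prod μ) := by
    refine Integrable.of_bound (Continuous.aestronglyMeasurable ?_) 1 ?_
    · fun_prop
    · filter_upwards [(Measure.quasiMeasurePreserving_snd (μ := ν.prod ν) (ν := μ)).ae hle]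
        with z hz
      rw [norm_cexp_eq]
      exact hz
  -- hence so is the `p`-integral, as a function on `Q × Q`
  have I3 : Integrable (fun x : (ℝ × ℝ) × (ℝ × ℝ) =>
      ∫ p, cexp ((((-(A * p 0 + B * p 1)) : ℝ) : ℂ) +
        (((x.1.1 - x.2.1) * p 2 + (x.1.2 - x.2.2) * p 3 : ℝ) : ℂ) * I) ∂μ) (ν.prod ν) :=
    I1.integral_prod_left
  -- commute `re` with the two outer integrals
  have step1 : ∀ᵐ w ∂ν, ∫ w', (∫ p, cexp ((((-(A * p 0 + B * p 1)) : ℝ) : ℂ) +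
        (((w.1 - w'.1) * p 2 + (w.2 - w'.2) * p 3 : ℝ) : ℂ) * I) ∂μ).re ∂ν
      = (∫ w', ∫ p, cexp ((((-(A * p 0 + B * p 1)) : ℝ) : ℂ) +
        (((w.1 - w'.1) * p 2 + (w.2 - w'.2) * p 3 : ℝ) : ℂ) * I) ∂μ ∂ν).re := by
    filter_upwards [I3.prod_right_ae] with w hw
    simpa only [RCLike.re_to_complex] using integral_re hw
  rw [integral_congr_ae step1]
  have step2 := integral_re I3.integral_prod_left
  simp only [RCLike.re_to_complex] at step2
  rw [step2, ← integral_prod _ I3,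
    integral_integral_swap (f := fun (x : (ℝ × ℝ) × (ℝ × ℝ)) (p : E4) =>
      cexp ((((-(A * p 0 + B * p 1)) : ℝ) : ℂ) +
        (((x.1.1 - x.2.1) * p 2 + (x.1.2 - x.2.2) * p 3 : ℝ) : ℂ) * I)) I1]
  have step3 : ∀ p : E4, ∫ x, cexp ((((-(A * p 0 + B * p 1)) : ℝ) : ℂ) +
      (((x.1.1 - x.2.1) * p 2 + (x.1.2 - x.2.2) * p 3 : ℝ) : ℂ) * I) ∂(ν.prod ν)
      = ((Real.exp (-(A * p 0 + B * p 1)) *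
          Complex.normSq (∫ w, cexp (((w.1 * p 2 + w.2 * p 3 : ℝ) : ℂ) * I) ∂ν) : ℝ) :
            ℂ) :=
    fun p => inner_integral ν p _
  rw [integral_congr_ae (ae_of_all _ step3), integral_complex_ofReal, Complex.ofReal_re]

end SmearedChartIdentity

/-- **Stub P1 · the smeared chart identity (Fubini).** For a finite positive measure `μ` on
`ℝ⁴` carried by the light cone `{p₀ ≥ |p₁|}` and the box `Q = [0,δ]²`, there is a bounded
measurable `Φ ≥ 0` on `ℝ⁴` (namely `Φ(p) = |∫_Q e^{i(w₁p₂ + w₂p₃)} dw|²`, with `Φ ≤ δ⁴`) such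
that for all `A > |B|` the weight `e^{-(A p₀ + B p₁)} Φ` is `μ`-integrable and the box-smeared
real part of the chart integral `ζ ↦ ∫ exp(-(A p₀ + B p₁) + i(ζ₁p₂ + ζ₂p₃)) dμ` equals
`∫ e^{-(A p₀ + B p₁)} Φ dμ`.
Registered stub `stub_smearedChartIdentity` of line `thales-slit-exact-cone-type`
(crux `PencilRigidity.ShellRigidity`, stmt-QuantumFields-11685); helper for
`stub_transversePinch`. -/
theorem stub_smearedChartIdentity (μ : Measure E4) [IsFiniteMeasure μ]
    (hcone : μ {p : E4 | p 0 < |p 1|} = 0) (δ : ℝ) (hδ : 0 < δ) :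
    ∃ Φ : E4 → ℝ, Measurable Φ ∧ (∀ p, 0 ≤ Φ p) ∧ (∃ M : ℝ, ∀ p, Φ p ≤ M) ∧
      ∀ A B : ℝ, |B| < A →
        Integrable (fun p : E4 => Real.exp (-(A * p 0 + B * p 1)) * Φ p) μ ∧
        ∫ w in Set.Icc (0 : ℝ) δ ×ˢ Set.Icc (0 : ℝ) δ, ∫ w' in Set.Icc (0 : ℝ) δ ×ˢ Set.Icc (0 : ℝ) δ,
            (∫ p, Complex.exp ((((-(A * p 0 + B * p 1)) : ℝ) : ℂ) +
              (((w.1 - w'.1) * p 2 + (w.2 - w'.2) * p 3 : ℝ) : ℂ) * Complex.I) ∂μ).re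
          = ∫ p, Real.exp (-(A * p 0 + B * p 1)) * Φ p ∂μ := by
  -- the box `Q = [0, δ]²` has Lebesgue measure `δ²`
  have hQreal :
      (volume : Measure (ℝ × ℝ)).real (Set.Icc (0 : ℝ) δ ×ˢ Set.Icc (0 : ℝ) δ) = δ ^ 2 := by
    rw [Measure.volume_eq_prod, measureReal_prod_prod, Real.volume_real_Icc_of_le hδ.le,
      sub_zero, sq]
  have hQfin : volume (Set.Icc (0 : ℝ) δ ×ˢ Set.Icc (0 : ℝ) δ) < ⊤ :=
    (isCompact_Icc.prod isCompact_Icc).measure_lt_top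
  haveI : IsFiniteMeasure ((volume : Measure (ℝ × ℝ)).restrict
      (Set.Icc (0 : ℝ) δ ×ˢ Set.Icc (0 : ℝ) δ)) :=
    ⟨by rwa [Measure.restrict_apply_univ]⟩
  have hsm := SmearedChartIdentity.stronglyMeasurable_boxIntegral
    ((volume : Measure (ℝ × ℝ)).restrict (Set.Icc (0 : ℝ) δ ×ˢ Set.Icc (0 : ℝ) δ))
  -- the bound `Φ ≤ λ(Q)² = δ⁴`
  have hbound : ∀ p : E4, Complex.normSq (∫ w in Set.Icc (0 : ℝ) δ ×ˢ Set.Icc (0 : ℝ) δ,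
      cexp (((w.1 * p 2 + w.2 * p 3 : ℝ) : ℂ) * I)) ≤ (δ ^ 2) ^ 2 := by
    intro p
    rw [Complex.normSq_eq_norm_sq]
    refine pow_le_pow_left₀ (norm_nonneg _) ?_ 2
    have h := norm_setIntegral_le_of_norm_le_const hQfin
      (f := fun w : ℝ × ℝ => cexp (((w.1 * p 2 + w.2 * p 3 : ℝ) : ℂ) * I))
      fun w _ => (Complex.norm_exp_ofReal_mul_I _).le
    rwa [one_mul, hQreal] at h
  refine ⟨fun p => Complex.normSq (∫ w in Set.Icc (0 : ℝ) δ ×ˢ Set.Icc (0 : ℝ) δ,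
      cexp (((w.1 * p 2 + w.2 * p 3 : ℝ) : ℂ) * I)),
    Complex.continuous_normSq.measurable.comp hsm.measurable, fun p => Complex.normSq_nonneg _,
    ⟨(δ ^ 2) ^ 2, hbound⟩, fun A B hAB => ?_⟩
  -- on the cone (that is, `μ`-almost everywhere) the weight is at most `1`
  have hle : ∀ᵐ p ∂μ, Real.exp (-(A * p 0 + B * p 1)) ≤ 1 := by
    filter_upwards [measure_eq_zero_iff_ae_notMem.1 hcone] with p hp
    exact SmearedChartIdentity.exp_weight_le_one hAB (not_lt.1 hp)
  refine ⟨?_, SmearedChartIdentity.smeared_identity μ _ A B hle⟩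
  refine Integrable.of_bound ?_ (1 * (δ ^ 2) ^ 2) ?_
  · exact ((by fun_prop :
        Continuous fun p : E4 => Real.exp (-(A * p 0 + B * p 1))).measurable.mul
      (Complex.continuous_normSq.measurable.comp hsm.measurable)).aestronglyMeasurable
  · filter_upwards [hle] with p hp
    rw [Real.norm_eq_abs,
      abs_of_nonneg (mul_nonneg (Real.exp_nonneg _) (Complex.normSq_nonneg _))]
    exact mul_le_mul hp (hbound p) (Complex.normSq_nonneg _) zero_le_one

end Summit.QuantumFields.YangMills.Cruxes.ShellRigidity.ThalesSlitExactConeType
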